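import Literature.Probability.Percolation.FourArmPivotalBound
import Literature.Probability.Percolation.FourArmBoundaryCut
import Literature.Probability.Percolation.OneArmBoundaryArmsMixed
import Literature.Combinatorics.SimpleGraph.MengerTwo
import HarnessLib

/-!
# The four-arm pivotal estimate near the boundary: per-site bounds (proofs only)

Topic `Literature/Probability/Percolation`; family `crit-perc`, statement **crit-perc.S16**
(`Literature.Probability.Percolation.triTheta_exponent`). Proofs only (no new definition, no new
named fact). For the pivotal sites `v` of the tree's order-free four-arm event
`armEvent ![T,F,T,F] r₀ N` in the boundary layer `N/2 < |v|_𝕋 ≤ N` (W. Werner, PCMI 2009, Lecture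
6, §5 with the proof of Lemma 6.2: "the contributions … of those `x`'s that are close to the
boundary of the hexagon do not matter"; Nolin 2008, §4.6 and §6.2, proof of Thm. 27, Case 3):

* `exists_cut_of_pivotal_plus_le` — the Menger defect of `FourArmPivotalCut.lean` for `|v|_𝕋 ≤ N`
  (sites of `∂Λ_N` included; same proof);
* `measureReal_inner_dom_local_eq`, `measureReal_inner_dom_four_eq`, `measureReal_inner_dom_six_eq`,
  `measureReal_le_of_subset_local_dom` — the product formula / union bound of
  `FourArmPivotalBound.lean` with the outer four-arm event replaced by an arbitrary event `C`
  determined by sites `z` with `|z|_𝕋 > R₁`, `|z - v|_𝕋 > 2^l` (here: the mixed half-plane pair);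
* `measureReal_isPivotal_fourArm_boundary_le` — **three factors**: for `|v|_𝕋 = k`, `k + d' = N`,
  `2^{l+1} ≤ d'`, inner radius `m₀`, domain annulus `d₂ < |· - v| ≤ D`:
  `P_t(v pivotal) ≤ π̂_t(r₀, m₀) · P_t(B_{T,F}(d₂ + d', D - d')) · (L_T + L_F)` with the local factors
  `L_c` of `measureReal_isPivotal_fourArm_le` and `B_{T,F}(m, n) = domArmEvent ![T,F] m n upperHalfPlane`
  (`pivotalPlus/Minus_subset_local`, `shift_mem_domArmEvent_mixed_of_cut`,
  `exists_rot_halfPlane_superset`, `shift_mem_domArmEvent_recenter`, `real_domArmEvent_rotPow`);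
* `measureReal_isPivotal_fourArm_boundary_two_le` — **two factors** (local factor dropped, any
  depth `d' ≥ 0`): `P_t(v pivotal) ≤ π̂_t(r₀, m₀) · P_t(B_{T,F}(d₂ + d', D - d'))`.

## References

* W. Werner, *Lectures on two-dimensional critical percolation*, IAS/Park City Math. Ser. 16
  (2009), Lecture 6, proof of Lemma 6.2 and §5 [WernerPCMI2009].
* P. Nolin, Near-critical percolation in two dimensions, *Electron. J. Probab.* 13 (2008), §4.6,
  §6.2 (proof of Thm. 27) [arXiv 0711.4948: Thm. 26] [Nolin2008].
* H. Kesten, Scaling relations for 2D-percolation, *Comm. Math. Phys.* 109 (1987) [KestenScalingCMP1987].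
-/

noncomputable section

open MeasureTheory Set

namespace Literature.Probability.Percolation

open LatticeModels Literature.Combinatorics.SimpleGraph

/-! ### The Menger defect for `|v|_𝕋 ≤ N` -/

/-- `exists_cut_of_pivotal_plus` for `|v|_𝕋 ≤ N` (the sites of `∂Λ_N` may be pivotal too; the
proof is verbatim the same). [cite: Nolin2008, §6.2, proof of Thm. 27, Case 3 (arXiv 0711.4948: Thm. 26)] [cite: Diestel2017, Thm. 3.3.1 and Cor. 3.3.5 (Menger, k = 2)] -/
theorem exists_cut_of_pivotal_plus_le {r₀ N : ℕ} {v : Site 2} {ω : SiteConfig (Site 2)}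
    (hr : (r₀ : ℤ) < triNorm v) (hN : triNorm v ≤ N)
    (hplus : insert v ω ∈ armEvent ![true, false, true, false] r₀ N)
    (hminus : ω \ {v} ∉ armEvent ![true, false, true, false] r₀ N) :
    ∃ (x₁ y₁ x₂ y₂ P : Site 2) (o₁ : triGraph.Walk x₁ y₁) (o₂ : triGraph.Walk x₂ y₂),
      triNorm x₁ = r₀ ∧ triNorm y₁ = N ∧ triNorm x₂ = r₀ ∧ triNorm y₂ = N ∧
      o₁.IsPath ∧ o₂.IsPath ∧
      (∀ z ∈ o₁.support, (r₀ : ℤ) ≤ triNorm z ∧ triNorm z ≤ N) ∧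
      (∀ z ∈ o₂.support, (r₀ : ℤ) ≤ triNorm z ∧ triNorm z ≤ N) ∧
      v ∈ o₁.support ∧ (∀ z ∈ o₁.support, z ≠ v → z ∈ ω) ∧
      (∀ z ∈ o₂.support, z ∈ ω ∧ z ≠ v) ∧ (∀ z ∈ o₁.support, z ∉ o₂.support) ∧
      P ∈ o₂.support ∧
      ∀ (s t : Site 2) (q : triGraph.Walk s t), triNorm s = r₀ → triNorm t = N →
        (∀ z ∈ q.support, ((r₀ : ℤ) ≤ triNorm z ∧ triNorm z ≤ N) ∧ z ∈ ω ∧ z ≠ v) →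
        P ∈ q.support := by
  classical
  have hrN : r₀ ≤ N := by
    have : (r₀ : ℤ) ≤ N := by omega
    exact_mod_cast this
  rw [armEvent_four_eq_inter] at hplus hminus
  obtain ⟨hO, hC⟩ := hplus
  -- the closed arms survive the closing of `v`
  have hC' : ω \ {v} ∈ armEvent (fun _ : Fin 2 => false) r₀ N :=
    isLowerSet_armEvent (fun _ => rfl) r₀ N
      (show ω \ {v} ≤ insert v ω from fun z hz => mem_insert_of_mem _ hz.1) hC
  have hO' : ω \ {v} ∉ armEvent (fun _ : Fin 2 => true) r₀ N := fun h => hminus ⟨h, hC'⟩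
  obtain ⟨x, y, w, hw, hdisj⟩ := hO
  -- the admissible set: open sites of `ω ∖ {v}` in the closed annulus
  obtain ⟨A, hA⟩ : ∃ A : Set (Site 2), ∀ z, z ∈ A ↔
      ((r₀ : ℤ) ≤ triNorm z ∧ triNorm z ≤ N) ∧ z ∈ ω ∧ z ≠ v := ⟨{z | _}, fun _ => Iff.rfl⟩
  have hann : ∀ j, ∀ z ∈ (w j).support, (r₀ : ℤ) ≤ triNorm z ∧ triNorm z ≤ N := fun j z hz =>
    mem_triAnnulus.1 (mem_triAnnulus_of_arm hrN ((hw j).2.2.2.1 z hz))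
  have hcol : ∀ j, ∀ z ∈ (w j).support, z ∈ insert v ω := fun j z hz => by
    simpa using (hw j).2.2.2.2 z hz
  -- `v` lies on one of the two open arms
  have hv : ∃ i, v ∈ (w i).support := by
    by_contra hcon
    push Not at hcon
    refine hO' ⟨x, y, w, fun j => ?_, hdisj⟩
    obtain ⟨hx, hy, hp, hs, -⟩ := hw j
    refine ⟨hx, hy, hp, hs, fun z hz => ?_⟩
    have hzv : z ≠ v := fun h => hcon j (h ▸ hz)
    have hzω : z ∈ ω := (mem_insert_iff.1 (hcol j z hz)).resolve_left hzv
    simp [hzω, hzv]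
  obtain ⟨i, hvi⟩ := hv
  obtain ⟨j, hji⟩ : ∃ j : Fin 2, j ≠ i := by
    fin_cases i
    · exact ⟨1, by decide⟩
    · exact ⟨0, by decide⟩
  have hdisj12 : ∀ z ∈ (w i).support, z ∉ (w j).support := fun z hz hz' =>
    Finset.disjoint_left.1 (hdisj hji.symm) (List.mem_toFinset.2 hz) (List.mem_toFinset.2 hz')
  have hvj : v ∉ (w j).support := hdisj12 v hvi
  have ho₂A : ∀ z ∈ (w j).support, z ∈ A := fun z hz =>
    (hA z).2 ⟨hann j z hz, (mem_insert_iff.1 (hcol j z hz)).resolve_left (fun h => hvj (h ▸ hz)),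
      fun h => hvj (h ▸ hz)⟩
  -- Menger's theorem for two paths
  have hone : ∃ (s t : Site 2) (q : triGraph.Walk s t), s ∈ (↑(triSphere r₀) : Set (Site 2)) ∧
      t ∈ (↑(triSphere N) : Set (Site 2)) ∧ ∀ z ∈ q.support, z ∈ A :=
    ⟨x j, y j, w j, (hw j).1, (hw j).2.1, ho₂A⟩
  have htwo : ¬ ∃ (s₁ t₁ s₂ t₂ : Site 2) (p₁ : triGraph.Walk s₁ t₁) (p₂ : triGraph.Walk s₂ t₂),
      s₁ ∈ (↑(triSphere r₀) : Set (Site 2)) ∧ t₁ ∈ (↑(triSphere N) : Set (Site 2)) ∧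
      s₂ ∈ (↑(triSphere r₀) : Set (Site 2)) ∧ t₂ ∈ (↑(triSphere N) : Set (Site 2)) ∧
      p₁.IsPath ∧ p₂.IsPath ∧ (∀ z ∈ p₁.support, z ∈ A) ∧ (∀ z ∈ p₂.support, z ∈ A) ∧
      ∀ z ∈ p₁.support, z ∉ p₂.support := by
    rintro ⟨s₁, t₁, s₂, t₂, p₁, p₂, hs₁, ht₁, hs₂, ht₂, -, -, hp₁A, hp₂A, hdj⟩
    obtain ⟨T, hT⟩ : ∃ T : Fin 2 → Set (Site 2),
        T 0 = {z | z ∈ p₁.support} ∧ T 1 = {z | z ∈ p₂.support} :=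
      ⟨![{z | z ∈ p₁.support}, {z | z ∈ p₂.support}], rfl, rfl⟩
    refine hO' (mem_armEvent_of_pathIn (fun _ : Fin 2 => true) T ?_ ?_ ?_ ?_)
    · intro a b hab
      fin_cases a <;> fin_cases b
      · exact absurd rfl hab
      · change Disjoint (T 0) (T 1)
        rw [hT.1, hT.2]; exact Set.disjoint_left.2 fun z hz hz' => hdj z hz hz'
      · change Disjoint (T 1) (T 0)
        rw [hT.1, hT.2]; exact Set.disjoint_left.2 fun z hz hz' => hdj z hz' hz
      · exact absurd rfl hab
    · intro a z hz
      fin_cases a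
      · change z ∈ T 0 at hz
        rw [hT.1] at hz
        obtain ⟨-, h2, h3⟩ := (hA z).1 (hp₁A z hz)
        simp [h2, h3]
      · change z ∈ T 1 at hz
        rw [hT.2] at hz
        obtain ⟨-, h2, h3⟩ := (hA z).1 (hp₂A z hz)
        simp [h2, h3]
    · intro a z hz
      fin_cases a
      · change z ∈ T 0 at hz
        rw [hT.1] at hz; exact ((hA z).1 (hp₁A z hz)).1
      · change z ∈ T 1 at hz
        rw [hT.2] at hz; exact ((hA z).1 (hp₂A z hz)).1
    · intro a
      fin_cases a
      · refine ⟨s₁, hs₁, t₁, ht₁, ?_⟩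
        change PathIn triGraph (T 0) s₁ t₁
        rw [hT.1]; exact PathIn.of_walk p₁ fun z hz => hz
      · refine ⟨s₂, hs₂, t₂, ht₂, ?_⟩
        change PathIn triGraph (T 1) s₂ t₂
        rw [hT.2]; exact PathIn.of_walk p₂ fun z hz => hz
  obtain ⟨P, hPA, hPall⟩ :=
    Literature.Combinatorics.SimpleGraph.exists_mem_support_forall hone htwo
  have hPo₂ : P ∈ (w j).support := hPall _ _ (w j) (hw j).1 (hw j).2.1 ho₂A
  refine ⟨x i, y i, x j, y j, P, w i, w j, mem_triSphere_iff.1 (hw i).1,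
    mem_triSphere_iff.1 (hw i).2.1, mem_triSphere_iff.1 (hw j).1, mem_triSphere_iff.1 (hw j).2.1,
    (hw i).2.2.1, (hw j).2.2.1, hann i, hann j, hvi,
    fun z hz hzv => (mem_insert_iff.1 (hcol i z hz)).resolve_left hzv,
    fun z hz => ⟨((hA z).1 (ho₂A z hz)).2.1, ((hA z).1 (ho₂A z hz)).2.2⟩, hdisj12, hPo₂,
    fun s t q hs ht hq => hPall s t q (mem_triSphere_iff.2 hs) (mem_triSphere_iff.2 ht)
      fun z hz => (hA z).2 (hq z hz)⟩

/-! ### Independence with an abstract outer event -/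

section Dom

variable {r₀ l R₁ : ℕ} {v : Site 2} {C : Set (SiteConfig (Site 2))} {H : Finset (Site 2)}

/-- `measureReal_inner_outer_local_le` with the outer event replaced by an event `C` determined by
sites `z` with `|z|_𝕋 > R₁` and `|z - v|_𝕋 > R`. [cite: Nolin2008, §6.2, proof of Thm. 27 ("by independence of the three events")] -/
theorem measureReal_inner_dom_local_eq (t : unitInterval) {κ₄ : Fin 4 → Bool} {κ₆ : Fin 6 → Bool}
    {d r' R : ℕ} (hd : 1 ≤ d) (hdr : d < r') (hr'R : r' ≤ R) (hR₀ : r₀ ≤ R₁)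
    (hR₁v : (R₁ : ℤ) + R < triNorm v) (hCH : DeterminedBy C ↑H)
    (hHm : ∀ z ∈ H, (R₁ : ℤ) < triNorm z ∧ (R : ℤ) < triNorm (z - v)) :
    (triSitePercolation t).real
        (armEvent ![true, false, true, false] r₀ R₁ ∩ C ∩
          SiteConfig.relabel (triShiftIso (-v)).toEquiv ⁻¹' (armEvent κ₄ 1 d ∩ armEvent κ₆ r' R)) =
      fourArmProbAt t r₀ R₁ * (triSitePercolation t).real C *
        ((triSitePercolation t).real (armEvent κ₄ 1 d) *
          (triSitePercolation t).real (armEvent κ₆ r' R)) := by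
  classical
  set e := (triShiftIso (-v)).toEquiv with he
  set A : Set (SiteConfig (Site 2)) := armEvent ![true, false, true, false] r₀ R₁ with hA
  set B₁ : Set (SiteConfig (Site 2)) := SiteConfig.relabel e ⁻¹' armEvent κ₄ 1 d with hB₁
  set B₂ : Set (SiteConfig (Site 2)) := SiteConfig.relabel e ⁻¹' armEvent κ₆ r' R with hB₂
  set F : Finset (Site 2) := triAnnulus r₀ R₁ with hF
  set G₁ : Finset (Site 2) := (triAnnulus 1 d).image fun u => u + v with hG₁
  set G₂ : Finset (Site 2) := (triAnnulus r' R).image fun u => u + v with hG₂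
  have hAF : DeterminedBy A ↑F := determinedBy_armEvent _ (by omega)
  have hBG₁ : DeterminedBy B₁ ↑G₁ := determinedBy_preimage_shift_armEvent' κ₄ hd v
  have hBG₂ : DeterminedBy B₂ ↑G₂ := determinedBy_preimage_shift_armEvent' κ₆ hr'R v
  have hG₁mem : ∀ z ∈ G₁, triNorm v - d ≤ triNorm z ∧ triNorm z ≤ triNorm v + d ∧
      (1 : ℤ) ≤ triNorm (z - v) ∧ triNorm (z - v) ≤ d := by
    intro z hz
    rw [hG₁, Finset.mem_image] at hz
    obtain ⟨u, hu, rfl⟩ := hz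
    rw [mem_triAnnulus] at hu
    have h1 := triNorm_add_le u v
    have h2 := triNorm_add_le (u + v) (-u)
    rw [add_neg_cancel_comm, triNorm_neg] at h2
    rw [add_sub_cancel_right]
    push_cast at hu
    omega
  have hG₂mem : ∀ z ∈ G₂, triNorm v - R ≤ triNorm z ∧ triNorm z ≤ triNorm v + R ∧
      (r' : ℤ) ≤ triNorm (z - v) ∧ triNorm (z - v) ≤ R := by
    intro z hz
    rw [hG₂, Finset.mem_image] at hz
    obtain ⟨u, hu, rfl⟩ := hz
    rw [mem_triAnnulus] at hu
    have h1 := triNorm_add_le u v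
    have h2 := triNorm_add_le (u + v) (-u)
    rw [add_neg_cancel_comm, triNorm_neg] at h2
    rw [add_sub_cancel_right]
    omega
  have hdR : (d : ℤ) ≤ R := by exact_mod_cast (show d ≤ R by omega)
  have hFG₁ : Disjoint F G₁ := Finset.disjoint_left.2 fun z hzF hzG => by
    rw [hF, mem_triAnnulus] at hzF; have := (hG₁mem z hzG).1; omega
  have hFG₂ : Disjoint F G₂ := Finset.disjoint_left.2 fun z hzF hzG => by
    rw [hF, mem_triAnnulus] at hzF; have := (hG₂mem z hzG).1; omega
  have hFH : Disjoint F H := Finset.disjoint_left.2 fun z hzF hzH => by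
    rw [hF, mem_triAnnulus] at hzF; have := (hHm z hzH).1; omega
  have hG₁H : Disjoint G₁ H := Finset.disjoint_left.2 fun z hzG hzH => by
    have := (hHm z hzH).2; have := (hG₁mem z hzG).2.2.2; omega
  have hG₂H : Disjoint G₂ H := Finset.disjoint_left.2 fun z hzG hzH => by
    have := (hHm z hzH).2; have := (hG₂mem z hzG).2.2.2; omega
  have hG₁G₂ : Disjoint G₁ G₂ := Finset.disjoint_left.2 fun z hz₁ hz₂ => by
    have h1 := (hG₁mem z hz₁).2.2.2; have h2 := (hG₂mem z hz₂).2.2.1; omega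
  -- independence
  have hB : DeterminedBy (B₁ ∩ B₂) ↑(G₁ ∪ G₂) :=
    (hBG₁.mono (by rw [Finset.coe_union]; exact subset_union_left)).inter
      (hBG₂.mono (by rw [Finset.coe_union]; exact subset_union_right))
  have hAC : DeterminedBy (A ∩ C) ↑(F ∪ H) :=
    (hAF.mono (by rw [Finset.coe_union]; exact subset_union_left)).inter
      (hCH.mono (by rw [Finset.coe_union]; exact subset_union_right))
  have hdisj : Disjoint (F ∪ H) (G₁ ∪ G₂) := by
    rw [Finset.disjoint_union_left, Finset.disjoint_union_right, Finset.disjoint_union_right]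
    exact ⟨⟨hFG₁, hFG₂⟩, hG₁H.symm, hG₂H.symm⟩
  have h1 : (triSitePercolation t).real (A ∩ C ∩ (B₁ ∩ B₂)) =
      (triSitePercolation t).real (A ∩ C) * (triSitePercolation t).real (B₁ ∩ B₂) :=
    sitePercolation_real_inter_of_disjoint t hAC hB hdisj
  have h2 : (triSitePercolation t).real (A ∩ C) =
      (triSitePercolation t).real A * (triSitePercolation t).real C :=
    sitePercolation_real_inter_of_disjoint t hAF hCH hFH
  have h3 : (triSitePercolation t).real (B₁ ∩ B₂) =
      (triSitePercolation t).real B₁ * (triSitePercolation t).real B₂ :=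
    sitePercolation_real_inter_of_disjoint t hBG₁ hBG₂ hG₁G₂
  have h4 : (triSitePercolation t).real B₁ = (triSitePercolation t).real (armEvent κ₄ 1 d) := by
    rw [hB₁, triSitePercolation]; exact sitePercolation_real_preimage_relabel e t _
  have h5 : (triSitePercolation t).real B₂ = (triSitePercolation t).real (armEvent κ₆ r' R) := by
    rw [hB₂, triSitePercolation]; exact sitePercolation_real_preimage_relabel e t _
  have hpre : SiteConfig.relabel e ⁻¹' (armEvent κ₄ 1 d ∩ armEvent κ₆ r' R) = B₁ ∩ B₂ := by
    rw [hB₁, hB₂, Set.preimage_inter]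
  rw [hpre, h1, h2, h3, h4, h5]
  rfl

/-- `measureReal_inner_outer_four_le` with an abstract outer event. [cite: Nolin2008, §6.2, proof of Thm. 27] -/
theorem measureReal_inner_dom_four_eq (t : unitInterval) {κ₄ : Fin 4 → Bool} {d R : ℕ}
    (hd : 1 ≤ d) (hdR : d ≤ R) (hR₀ : r₀ ≤ R₁) (hR₁v : (R₁ : ℤ) + R < triNorm v) (hCH : DeterminedBy C ↑H)
    (hHm : ∀ z ∈ H, (R₁ : ℤ) < triNorm z ∧ (R : ℤ) < triNorm (z - v)) :
    (triSitePercolation t).real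
        (armEvent ![true, false, true, false] r₀ R₁ ∩ C ∩
          SiteConfig.relabel (triShiftIso (-v)).toEquiv ⁻¹' armEvent κ₄ 1 d) =
      fourArmProbAt t r₀ R₁ * (triSitePercolation t).real C *
        (triSitePercolation t).real (armEvent κ₄ 1 d) := by
  classical
  set e := (triShiftIso (-v)).toEquiv with he
  set A : Set (SiteConfig (Site 2)) := armEvent ![true, false, true, false] r₀ R₁ with hA
  set B₁ : Set (SiteConfig (Site 2)) := SiteConfig.relabel e ⁻¹' armEvent κ₄ 1 d with hB₁
  set F : Finset (Site 2) := triAnnulus r₀ R₁ with hF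
  set G₁ : Finset (Site 2) := (triAnnulus 1 d).image fun u => u + v with hG₁
  have hAF : DeterminedBy A ↑F := determinedBy_armEvent _ (by omega)
  have hBG₁ : DeterminedBy B₁ ↑G₁ := determinedBy_preimage_shift_armEvent' κ₄ hd v
  have hG₁mem : ∀ z ∈ G₁, triNorm v - d ≤ triNorm z ∧ triNorm (z - v) ≤ d := by
    intro z hz
    rw [hG₁, Finset.mem_image] at hz
    obtain ⟨u, hu, rfl⟩ := hz
    rw [mem_triAnnulus] at hu
    have h1 := triNorm_add_le u v
    have h2 := triNorm_add_le (u + v) (-u)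
    rw [add_neg_cancel_comm, triNorm_neg] at h2
    rw [add_sub_cancel_right]
    push_cast at hu
    omega
  have hFG₁ : Disjoint F G₁ := Finset.disjoint_left.2 fun z hzF hzG => by
    rw [hF, mem_triAnnulus] at hzF; have := (hG₁mem z hzG).1; omega
  have hFH : Disjoint F H := Finset.disjoint_left.2 fun z hzF hzH => by
    rw [hF, mem_triAnnulus] at hzF; have := (hHm z hzH).1; omega
  have hG₁H : Disjoint G₁ H := Finset.disjoint_left.2 fun z hzG hzH => by
    have := (hHm z hzH).2; have := (hG₁mem z hzG).2; omega
  have hAC : DeterminedBy (A ∩ C) ↑(F ∪ H) :=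
    (hAF.mono (by rw [Finset.coe_union]; exact subset_union_left)).inter
      (hCH.mono (by rw [Finset.coe_union]; exact subset_union_right))
  have hdisj : Disjoint (F ∪ H) G₁ := by
    rw [Finset.disjoint_union_left]; exact ⟨hFG₁, hG₁H.symm⟩
  have h1 : (triSitePercolation t).real (A ∩ C ∩ B₁) =
      (triSitePercolation t).real (A ∩ C) * (triSitePercolation t).real B₁ :=
    sitePercolation_real_inter_of_disjoint t hAC hBG₁ hdisj
  have h2 : (triSitePercolation t).real (A ∩ C) =
      (triSitePercolation t).real A * (triSitePercolation t).real C :=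
    sitePercolation_real_inter_of_disjoint t hAF hCH hFH
  have h4 : (triSitePercolation t).real B₁ = (triSitePercolation t).real (armEvent κ₄ 1 d) := by
    rw [hB₁, triSitePercolation]; exact sitePercolation_real_preimage_relabel e t _
  rw [h1, h2, h4]
  rfl

/-- `measureReal_inner_outer_six_le` with an abstract outer event. [cite: Nolin2008, §6.2, proof of Thm. 27] -/
theorem measureReal_inner_dom_six_eq (t : unitInterval) {κ₆ : Fin 6 → Bool} {r' R : ℕ}
    (hr'R : r' ≤ R) (hR₀ : r₀ ≤ R₁) (hR₁v : (R₁ : ℤ) + R < triNorm v) (hCH : DeterminedBy C ↑H)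
    (hHm : ∀ z ∈ H, (R₁ : ℤ) < triNorm z ∧ (R : ℤ) < triNorm (z - v)) :
    (triSitePercolation t).real
        (armEvent ![true, false, true, false] r₀ R₁ ∩ C ∩
          SiteConfig.relabel (triShiftIso (-v)).toEquiv ⁻¹' armEvent κ₆ r' R) =
      fourArmProbAt t r₀ R₁ * (triSitePercolation t).real C *
        (triSitePercolation t).real (armEvent κ₆ r' R) := by
  classical
  set e := (triShiftIso (-v)).toEquiv with he
  set A : Set (SiteConfig (Site 2)) := armEvent ![true, false, true, false] r₀ R₁ with hA
  set B₂ : Set (SiteConfig (Site 2)) := SiteConfig.relabel e ⁻¹' armEvent κ₆ r' R with hB₂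
  set F : Finset (Site 2) := triAnnulus r₀ R₁ with hF
  set G₂ : Finset (Site 2) := (triAnnulus r' R).image fun u => u + v with hG₂
  have hAF : DeterminedBy A ↑F := determinedBy_armEvent _ (by omega)
  have hBG₂ : DeterminedBy B₂ ↑G₂ := determinedBy_preimage_shift_armEvent' κ₆ hr'R v
  have hG₂mem : ∀ z ∈ G₂, triNorm v - R ≤ triNorm z ∧ triNorm (z - v) ≤ R := by
    intro z hz
    rw [hG₂, Finset.mem_image] at hz
    obtain ⟨u, hu, rfl⟩ := hz
    rw [mem_triAnnulus] at hu
    have h1 := triNorm_add_le u v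
    have h2 := triNorm_add_le (u + v) (-u)
    rw [add_neg_cancel_comm, triNorm_neg] at h2
    rw [add_sub_cancel_right]
    omega
  have hFG₂ : Disjoint F G₂ := Finset.disjoint_left.2 fun z hzF hzG => by
    rw [hF, mem_triAnnulus] at hzF; have := (hG₂mem z hzG).1; omega
  have hFH : Disjoint F H := Finset.disjoint_left.2 fun z hzF hzH => by
    rw [hF, mem_triAnnulus] at hzF; have := (hHm z hzH).1; omega
  have hG₂H : Disjoint G₂ H := Finset.disjoint_left.2 fun z hzG hzH => by
    have := (hHm z hzH).2; have := (hG₂mem z hzG).2; omega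
  have hAC : DeterminedBy (A ∩ C) ↑(F ∪ H) :=
    (hAF.mono (by rw [Finset.coe_union]; exact subset_union_left)).inter
      (hCH.mono (by rw [Finset.coe_union]; exact subset_union_right))
  have hdisj : Disjoint (F ∪ H) G₂ := by
    rw [Finset.disjoint_union_left]; exact ⟨hFG₂, hG₂H.symm⟩
  have h1 : (triSitePercolation t).real (A ∩ C ∩ B₂) =
      (triSitePercolation t).real (A ∩ C) * (triSitePercolation t).real B₂ :=
    sitePercolation_real_inter_of_disjoint t hAC hBG₂ hdisj
  have h2 : (triSitePercolation t).real (A ∩ C) =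
      (triSitePercolation t).real A * (triSitePercolation t).real C :=
    sitePercolation_real_inter_of_disjoint t hAF hCH hFH
  have h5 : (triSitePercolation t).real B₂ = (triSitePercolation t).real (armEvent κ₆ r' R) := by
    rw [hB₂, triSitePercolation]; exact sitePercolation_real_preimage_relabel e t _
  rw [h1, h2, h5]
  rfl

/-- `measureReal_le_of_subset_local` with an abstract outer event `C` (union bound and
independence). [cite: Nolin2008, §6.2, proof of Thm. 27, Case 3 (arXiv 0711.4948: Thm. 26)] -/
theorem measureReal_le_of_subset_local_dom (t : unitInterval) (c : Bool) (hl : 1 ≤ l)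
    (hR₀ : r₀ ≤ R₁) (hR₁v : (R₁ : ℤ) + 2 ^ l < triNorm v) (hCH : DeterminedBy C ↑H)
    (hHm : ∀ z ∈ H, (R₁ : ℤ) < triNorm z ∧ (2 : ℤ) ^ l < triNorm (z - v)) {S : Set (SiteConfig (Site 2))}
    (hin : S ⊆ armEvent ![true, false, true, false] r₀ R₁)
    (hout : S ⊆ C)
    (hloc : S ⊆ SiteConfig.relabel (triShiftIso (-v)).toEquiv ⁻¹'
      ((armEvent ![c, !c, c, !c] 1 (2 ^ (l - 1)) ∪ armEvent ![c, c, c, c, !c, !c] 2 (2 ^ l)) ∪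
        ⋃ l' ∈ Finset.Ico 1 l, (armEvent ![c, !c, c, !c] 1 (2 ^ (l' - 1)) ∩
          armEvent ![c, c, c, c, !c, !c] (2 ^ (l' + 1)) (2 ^ l)))) :
    (triSitePercolation t).real S ≤
      fourArmProbAt t r₀ R₁ * (triSitePercolation t).real C *
        (fourArmProbAt t 1 (2 ^ (l - 1)) +
          (triSitePercolation t).real (armEvent ![c, c, c, c, !c, !c] 2 (2 ^ l)) +
          ∑ l' ∈ Finset.Ico 1 l, fourArmProbAt t 1 (2 ^ (l' - 1)) *
            (triSitePercolation t).real (armEvent ![c, c, c, c, !c, !c] (2 ^ (l' + 1)) (2 ^ l))) := by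
  classical
  set μ := triSitePercolation t with hμ
  set e := (triShiftIso (-v)).toEquiv with he
  set A := armEvent ![true, false, true, false] r₀ R₁ with hA
  set T₀ := SiteConfig.relabel e ⁻¹' armEvent ![c, !c, c, !c] 1 (2 ^ (l - 1)) with hT₀
  set T₁ := SiteConfig.relabel e ⁻¹' armEvent ![c, c, c, c, !c, !c] 2 (2 ^ l) with hT₁
  set T : ℕ → Set (SiteConfig (Site 2)) := fun l' => SiteConfig.relabel e ⁻¹'
    (armEvent ![c, !c, c, !c] 1 (2 ^ (l' - 1)) ∩
      armEvent ![c, c, c, c, !c, !c] (2 ^ (l' + 1)) (2 ^ l)) with hT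
  have h2l : 2 ^ (l - 1) ≤ 2 ^ l := Nat.pow_le_pow_right (by norm_num) (by omega)
  have h2l' : (1 : ℕ) ≤ 2 ^ (l - 1) := Nat.one_le_two_pow
  have h22 : 2 ≤ 2 ^ l := by
    calc 2 = 2 ^ 1 := by norm_num
      _ ≤ 2 ^ l := Nat.pow_le_pow_right (by norm_num) hl
  have hcast : ((2 ^ l : ℕ) : ℤ) = (2 : ℤ) ^ l := by push_cast; ring
  have hR₁v' : (R₁ : ℤ) + ((2 ^ l : ℕ) : ℤ) < triNorm v := by rw [hcast]; exact hR₁v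
  have hHm' : ∀ z ∈ H, (R₁ : ℤ) < triNorm z ∧ ((2 ^ l : ℕ) : ℤ) < triNorm (z - v) := by
    intro z hz; rw [hcast]; exact hHm z hz
  -- `S` inside the union of the pieces, each intersected with `A ∩ C`
  have hS : S ⊆ (A ∩ C ∩ T₀ ∪ A ∩ C ∩ T₁) ∪ ⋃ l' ∈ Finset.Ico 1 l, A ∩ C ∩ T l' := by
    intro ω hω
    have hAω := hin hω
    have hCω := hout hω
    have hL := hloc hω
    simp only [mem_preimage, mem_union, mem_iUnion, exists_prop] at hL
    rcases hL with (h | h) | ⟨l', hl', h⟩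
    · exact mem_union_left _ (mem_union_left _ ⟨⟨hAω, hCω⟩, h⟩)
    · exact mem_union_left _ (mem_union_right _ ⟨⟨hAω, hCω⟩, h⟩)
    · exact mem_union_right _ (mem_iUnion₂.2 ⟨l', hl', ⟨hAω, hCω⟩, h⟩)
  -- the four-arm probabilities of colour `c` are `fourArmProbAt`
  have h4 : ∀ r R : ℕ, μ.real (armEvent ![c, !c, c, !c] r R) = fourArmProbAt t r R := fun r R => by
    rw [hμ, fourArmProbAt, armEvent_altFour_eq]
  -- the pieces
  have e₀ : μ.real (A ∩ C ∩ T₀) = fourArmProbAt t r₀ R₁ * μ.real C *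
      fourArmProbAt t 1 (2 ^ (l - 1)) := by
    rw [hμ, hA, hT₀, measureReal_inner_dom_four_eq t h2l' h2l hR₀ hR₁v' hCH hHm', ← hμ, h4]
  have e₁ : μ.real (A ∩ C ∩ T₁) = fourArmProbAt t r₀ R₁ * μ.real C *
      μ.real (armEvent ![c, c, c, c, !c, !c] 2 (2 ^ l)) := by
    rw [hμ, hA, hT₁, measureReal_inner_dom_six_eq t h22 hR₀ hR₁v' hCH hHm']
  have e₂ : ∀ l' ∈ Finset.Ico 1 l, μ.real (A ∩ C ∩ T l') =
      fourArmProbAt t r₀ R₁ * μ.real C *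
        (fourArmProbAt t 1 (2 ^ (l' - 1)) *
          μ.real (armEvent ![c, c, c, c, !c, !c] (2 ^ (l' + 1)) (2 ^ l))) := by
    intro l' hl'
    rw [Finset.mem_Ico] at hl'
    have hd : (1 : ℕ) ≤ 2 ^ (l' - 1) := Nat.one_le_two_pow
    have hdr : 2 ^ (l' - 1) < 2 ^ (l' + 1) := Nat.pow_lt_pow_right (by norm_num) (by omega)
    have hr'R : 2 ^ (l' + 1) ≤ 2 ^ l := Nat.pow_le_pow_right (by norm_num) (by omega)
    rw [hμ, hA, hT]
    simp only
    rw [measureReal_inner_dom_local_eq t hd hdr hr'R hR₀ hR₁v' hCH hHm', ← hμ, h4]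
  have hnn : 0 ≤ fourArmProbAt t r₀ R₁ * μ.real C :=
    mul_nonneg (fourArmProbAt_nonneg _ _ _) measureReal_nonneg
  calc μ.real S ≤ μ.real ((A ∩ C ∩ T₀ ∪ A ∩ C ∩ T₁) ∪ ⋃ l' ∈ Finset.Ico 1 l, A ∩ C ∩ T l') :=
        measureReal_mono hS (measure_ne_top _ _)
    _ ≤ μ.real (A ∩ C ∩ T₀ ∪ A ∩ C ∩ T₁) + μ.real (⋃ l' ∈ Finset.Ico 1 l, A ∩ C ∩ T l') :=
        measureReal_union_le _ _
    _ ≤ (μ.real (A ∩ C ∩ T₀) + μ.real (A ∩ C ∩ T₁)) +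
          ∑ l' ∈ Finset.Ico 1 l, μ.real (A ∩ C ∩ T l') :=
        add_le_add (measureReal_union_le _ _) (measureReal_biUnion_finset_le _ _)
    _ = fourArmProbAt t r₀ R₁ * μ.real C *
          (fourArmProbAt t 1 (2 ^ (l - 1)) + μ.real (armEvent ![c, c, c, c, !c, !c] 2 (2 ^ l)) +
            ∑ l' ∈ Finset.Ico 1 l, fourArmProbAt t 1 (2 ^ (l' - 1)) *
              μ.real (armEvent ![c, c, c, c, !c, !c] (2 ^ (l' + 1)) (2 ^ l))) := by
        rw [e₀, e₁, Finset.sum_congr rfl e₂, ← Finset.mul_sum]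
        ring

end Dom

/-! ### Per-site bounds in the boundary layer -/

section Boundary

variable {r₀ N l m₀ D d₂ k d' : ℕ} {v : Site 2}

/-- **The mixed pair at a pivotal site, both cases**: if `v` is pivotal for
`armEvent ![T,F,T,F] r₀ N`, `r₀ + 2D ≤ |v|_𝕋 ≤ N`, `1 ≤ d₂`, `d₂ + 1 ≤ D`, then `ω - v` has an open
and a closed arm from `∂Λ_{d₂}` to `∂Λ_D` inside `{w | |w + v|_𝕋 ≤ N}` (Case⁺:
`shift_mem_domArmEvent_mixed_of_cut`; Case⁻: the same for `ωᶜ`, the mixed pair being colour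
symmetric). [cite: WernerPCMI2009, Lecture 6, proof of Lemma 6.2 (boundary contributions) and §5] [cite: Nolin2008, §4.6 and §6.2, proof of Thm. 27, Case 3 (arXiv 0711.4948: Thm. 26)] -/
theorem shift_mem_domArmEvent_mixed_of_isPivotal (hD : 1 ≤ D) (hvr : (r₀ : ℤ) + 2 * D ≤ triNorm v)
    (hvN : triNorm v ≤ N) {ω : SiteConfig (Site 2)}
    (hpiv : IsPivotal (armEvent ![true, false, true, false] r₀ N) v ω) (hd₂ : 1 ≤ d₂)
    (hd₂D : d₂ + 1 ≤ D) :
    SiteConfig.relabel (triShiftIso (-v)).toEquiv ω ∈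
      domArmEvent ![true, false] d₂ D {w | triNorm (w + v) ≤ N} := by
  have key : ∀ ζ : SiteConfig (Site 2), insert v ζ ∈ armEvent ![true, false, true, false] r₀ N →
      ζ \ {v} ∉ armEvent ![true, false, true, false] r₀ N →
      SiteConfig.relabel (triShiftIso (-v)).toEquiv ζ ∈
        domArmEvent ![true, false] d₂ D {w | triNorm (w + v) ≤ N} := by
    intro ζ hplus hminus
    obtain ⟨x₁, y₁, x₂, y₂, P, o₁, o₂, hx₁, hy₁, -, -, -, -, ho₁ann, -, hvo₁, ho₁ω, -, hdisj, hPo₂,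
      hcut⟩ := exists_cut_of_pivotal_plus_le (by omega) hvN hplus hminus
    exact shift_mem_domArmEvent_mixed_of_cut o₁ hD hvr hvN hx₁ hy₁ ho₁ann hvo₁ ho₁ω
      (fun h => hdisj P h hPo₂) hcut hd₂ hd₂D
  rcases hpiv with ⟨hplus, hminus⟩ | ⟨hminus, hplus⟩
  · exact key ω hplus hminus
  · have hins : insert v ωᶜ = (ω \ {v})ᶜ := by
      ext z; simp [mem_insert_iff]; tauto
    have hdiff : ωᶜ \ {v} = (insert v ω)ᶜ := by
      ext z; simp [mem_insert_iff]; tauto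
    have hplus' : insert v ωᶜ ∈ armEvent ![true, false, true, false] r₀ N := by
      rw [hins, compl_mem_armEvent_four_iff]; exact hminus
    have hminus' : ωᶜ \ {v} ∉ armEvent ![true, false, true, false] r₀ N := by
      rw [hdiff, compl_mem_armEvent_four_iff]; exact hplus
    have h := key ωᶜ hplus' hminus'
    rw [relabel_compl, ← Set.mem_preimage, compl_preimage_domArmEvent, not_mixed_eq_comp_swap,
      domArmEvent_comp_equiv] at h
    exact h

/-- **Three factors for a pivotal site of the four-arm event near the boundary** (Werner 2009,
Lecture 6, proof of Lemma 6.2, boundary contributions, with §5; Nolin 2008, §4.6 and §6.2, Case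
3): for `|v|_𝕋 = k`, `k + d' = N`, `l ≥ 1`, `r₀ + 2·2^l ≤ k`, `2·2^l ≤ d'`, `r₀ ≤ m₀`, `1 ≤ D`,
`r₀ + 2D ≤ k`, `m₀ + D < k`, `2^l < d₂`, `d₂ + 2d' + 1 ≤ D`:
`P_t(v pivotal) ≤ π̂_t(r₀, m₀) · P_t(B_{T,F}(d₂ + d', D - d')) · (L_T + L_F)`,
`B_{T,F}(m, n) = domArmEvent ![T,F] m n upperHalfPlane`, `L_c` the local factors of
`measureReal_isPivotal_fourArm_le` (inner four arms, the local event with its defect, and the mixed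
half-plane pair of `shift_mem_domArmEvent_mixed_of_isPivotal`, recentred at a site `t` of `∂Λ_{d'}`
and rotated; the three are determined by disjoint site sets). [cite: WernerPCMI2009, Lecture 6, proof of Lemma 6.2 (boundary contributions) and §5] [cite: Nolin2008, §4.6 and §6.2, proof of Thm. 27, Case 3 (arXiv 0711.4948: Thm. 26)] -/
theorem measureReal_isPivotal_fourArm_boundary_le (t : unitInterval) (hk : triNorm v = k)
    (hkN : k + d' = N) (hl : 1 ≤ l) (hvr : r₀ + 2 * 2 ^ l ≤ k) (hld : 2 * 2 ^ l ≤ d')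
    (hr₀m : r₀ ≤ m₀) (hD : 1 ≤ D) (h2D : r₀ + 2 * D ≤ k) (hmD : m₀ + D < k) (hd₂ : 2 ^ l < d₂)
    (hrec : d₂ + 2 * d' + 1 ≤ D) :
    (triSitePercolation t).real {ω | IsPivotal (armEvent ![true, false, true, false] r₀ N) v ω} ≤
      fourArmProbAt t r₀ m₀ *
        (triSitePercolation t).real (domArmEvent ![true, false] (d₂ + d') (D - d') upperHalfPlane) *
        ∑ c : Bool, (fourArmProbAt t 1 (2 ^ (l - 1)) +
          (triSitePercolation t).real (armEvent ![c, c, c, c, !c, !c] 2 (2 ^ l)) +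
          ∑ l' ∈ Finset.Ico 1 l, fourArmProbAt t 1 (2 ^ (l' - 1)) *
            (triSitePercolation t).real (armEvent ![c, c, c, c, !c, !c] (2 ^ (l' + 1)) (2 ^ l))) := by
  classical
  obtain ⟨j, -, tt, htt, hdom⟩ := exists_rot_halfPlane_superset (N := N) hk hkN
  set G : Set (Site 2) := (triRotIsoPow j) '' upperHalfPlane with hG
  set Hd : Set (Site 2) := {w | triNorm (w + v) ≤ N} with hHd
  set C : Set (SiteConfig (Site 2)) :=
    SiteConfig.relabel (triShiftIso (-v)).toEquiv ⁻¹' domArmEvent ![true, false] d₂ D Hd with hC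
  set H : Finset (Site 2) := (triAnnulus d₂ D).image fun u => u + v with hH
  have hCH : DeterminedBy C ↑H :=
    determinedBy_preimage_shift (determinedBy_domArmEvent _ (by omega) Hd) v
  have hcast : ((2 ^ l : ℕ) : ℤ) = (2 : ℤ) ^ l := by push_cast; ring
  have hHm : ∀ z ∈ H, (m₀ : ℤ) < triNorm z ∧ (2 : ℤ) ^ l < triNorm (z - v) := by
    intro z hz
    rw [hH, Finset.mem_image] at hz
    obtain ⟨u, hu, rfl⟩ := hz
    rw [mem_triAnnulus] at hu
    have h1 := triNorm_add_le (u + v) (-u)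
    rw [add_neg_cancel_comm, triNorm_neg] at h1
    rw [add_sub_cancel_right, ← hcast]
    have hd₂' : ((2 ^ l : ℕ) : ℤ) < d₂ := by exact_mod_cast hd₂
    constructor
    · rw [hk] at h1; omega
    · omega
  have hvr' : (r₀ : ℤ) + 2 * 2 ^ l ≤ triNorm v := by rw [hk]; exact_mod_cast hvr
  have hvN' : triNorm v + 2 * 2 ^ l ≤ N := by rw [hk]; exact_mod_cast (show k + 2 * 2 ^ l ≤ N by omega)
  have hvD : (r₀ : ℤ) + 2 * D ≤ triNorm v := by rw [hk]; exact_mod_cast h2D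
  have hvN : triNorm v ≤ N := by rw [hk]; exact_mod_cast (show k ≤ N by omega)
  have hm₀v : (m₀ : ℤ) + 2 ^ l < triNorm v := by
    rw [hk]
    have : (2 : ℤ) ^ l ≤ D := by
      have h1 : 2 ^ l < d₂ := hd₂
      exact_mod_cast (show 2 ^ l ≤ D by omega)
    have : ((m₀ : ℤ) + D < k) := by exact_mod_cast hmD
    omega
  -- the bound for one case, `S ⊆ pivotal`, with its local shape
  have hcase : ∀ (c : Bool) (S : Set (SiteConfig (Site 2))),
      S ⊆ {ω | IsPivotal (armEvent ![true, false, true, false] r₀ N) v ω} →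
      S ⊆ SiteConfig.relabel (triShiftIso (-v)).toEquiv ⁻¹'
        ((armEvent ![c, !c, c, !c] 1 (2 ^ (l - 1)) ∪ armEvent ![c, c, c, c, !c, !c] 2 (2 ^ l)) ∪
          ⋃ l' ∈ Finset.Ico 1 l, (armEvent ![c, !c, c, !c] 1 (2 ^ (l' - 1)) ∩
            armEvent ![c, c, c, c, !c, !c] (2 ^ (l' + 1)) (2 ^ l))) →
      (triSitePercolation t).real S ≤ fourArmProbAt t r₀ m₀ * (triSitePercolation t).real C *
        (fourArmProbAt t 1 (2 ^ (l - 1)) +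
          (triSitePercolation t).real (armEvent ![c, c, c, c, !c, !c] 2 (2 ^ l)) +
          ∑ l' ∈ Finset.Ico 1 l, fourArmProbAt t 1 (2 ^ (l' - 1)) *
            (triSitePercolation t).real (armEvent ![c, c, c, c, !c, !c] (2 ^ (l' + 1)) (2 ^ l))) := by
    intro c S hS hloc
    refine measureReal_le_of_subset_local_dom t c hl hr₀m hm₀v hCH hHm ?_ ?_ hloc
    · exact hS.trans (isPivotal_armEvent_subset_inner hr₀m (by omega) (by rw [hk]; exact_mod_cast
        (show m₀ < k by omega)))
    · intro ω hω
      exact shift_mem_domArmEvent_mixed_of_isPivotal hD hvD hvN (hS hω) (by omega) (by omega)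
  -- the two cases
  have hp := hcase true {ω | insert v ω ∈ armEvent ![true, false, true, false] r₀ N ∧
      ω \ {v} ∉ armEvent ![true, false, true, false] r₀ N} (fun ω hω => Or.inl hω)
    (fun ω hω => pivotalPlus_subset_local hl hvr' hvN' hω.1 hω.2)
  have hm := hcase false {ω | ω \ {v} ∈ armEvent ![true, false, true, false] r₀ N ∧
      insert v ω ∉ armEvent ![true, false, true, false] r₀ N} (fun ω hω => Or.inr hω)
    (fun ω hω => pivotalMinus_subset_local hl hvr' hvN' hω.1 hω.2)
  have hsplit : {ω : SiteConfig (Site 2) | IsPivotal (armEvent ![true, false, true, false] r₀ N) v ω} =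
      {ω | insert v ω ∈ armEvent ![true, false, true, false] r₀ N ∧
          ω \ {v} ∉ armEvent ![true, false, true, false] r₀ N} ∪
        {ω | ω \ {v} ∈ armEvent ![true, false, true, false] r₀ N ∧
          insert v ω ∉ armEvent ![true, false, true, false] r₀ N} := by
    ext ω; rfl
  -- the probability of `C`: recentre and rotate
  have hCle : (triSitePercolation t).real C ≤
      (triSitePercolation t).real (domArmEvent ![true, false] (d₂ + d') (D - d') upperHalfPlane) := by
    set C' : Set (SiteConfig (Site 2)) :=
      SiteConfig.relabel (triShiftIso (-(v + tt))).toEquiv ⁻¹'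
        domArmEvent ![true, false] (d₂ + d') (D - d') G with hC'
    have hCC' : C ⊆ C' := by
      intro ω hω
      have h3 := shift_mem_domArmEvent_recenter (κ := ![true, false]) (G := G) htt hrec hdom hω
      rw [relabel_shift_shift] at h3
      exact h3
    have h4 : (triSitePercolation t).real C' =
        (triSitePercolation t).real (domArmEvent ![true, false] (d₂ + d') (D - d') upperHalfPlane) := by
      rw [hC', triSitePercolation, sitePercolation_real_preimage_relabel, hG]
      exact real_domArmEvent_rotPow t _ _ _ j
    rw [← h4]
    exact measureReal_mono hCC' (measure_ne_top _ _)
  have hπ0 := fourArmProbAt_nonneg t r₀ m₀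
  have hL0 : ∀ c : Bool, 0 ≤ fourArmProbAt t 1 (2 ^ (l - 1)) +
      (triSitePercolation t).real (armEvent ![c, c, c, c, !c, !c] 2 (2 ^ l)) +
      ∑ l' ∈ Finset.Ico 1 l, fourArmProbAt t 1 (2 ^ (l' - 1)) *
        (triSitePercolation t).real (armEvent ![c, c, c, c, !c, !c] (2 ^ (l' + 1)) (2 ^ l)) := by
    intro c
    refine add_nonneg (add_nonneg (fourArmProbAt_nonneg _ _ _) measureReal_nonneg) ?_
    exact Finset.sum_nonneg fun l' _ => mul_nonneg (fourArmProbAt_nonneg _ _ _) measureReal_nonneg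
  rw [hsplit]
  refine (measureReal_union_le _ _).trans ?_
  rw [Fintype.sum_bool]
  simp only [Bool.not_true, Bool.not_false] at hp hm hL0 ⊢
  have hT := hL0 true
  have hF := hL0 false
  simp only [Bool.not_true, Bool.not_false] at hT hF
  have hCm : fourArmProbAt t r₀ m₀ * (triSitePercolation t).real C ≤ fourArmProbAt t r₀ m₀ *
      (triSitePercolation t).real (domArmEvent ![true, false] (d₂ + d') (D - d') upperHalfPlane) :=
    mul_le_mul_of_nonneg_left hCle hπ0
  have hC0 : 0 ≤ fourArmProbAt t r₀ m₀ * (triSitePercolation t).real C := mul_nonneg hπ0 measureReal_nonneg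
  nlinarith [hp, hm, mul_le_mul_of_nonneg_right hCm hT, mul_le_mul_of_nonneg_right hCm hF]

/-- **Two factors for a pivotal site at the boundary** (the local factor dropped; any depth
`d' ≥ 0`): for `|v|_𝕋 = k`, `k + d' = N`, `r₀ ≤ m₀`, `1 ≤ D`, `r₀ + 2D ≤ k`, `m₀ + D < k`, `1 ≤ d₂`,
`d₂ + 2d' + 1 ≤ D`: `P_t(v pivotal) ≤ π̂_t(r₀, m₀) · P_t(B_{T,F}(d₂ + d', D - d'))`. [cite: WernerPCMI2009, Lecture 6, proof of Lemma 6.2 (boundary contributions) and §5] -/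
theorem measureReal_isPivotal_fourArm_boundary_two_le (t : unitInterval) (hk : triNorm v = k)
    (hkN : k + d' = N) (hr₀m : r₀ ≤ m₀) (hD : 1 ≤ D) (h2D : r₀ + 2 * D ≤ k) (hmD : m₀ + D < k)
    (hd₂ : 1 ≤ d₂) (hrec : d₂ + 2 * d' + 1 ≤ D) :
    (triSitePercolation t).real {ω | IsPivotal (armEvent ![true, false, true, false] r₀ N) v ω} ≤
      fourArmProbAt t r₀ m₀ *
        (triSitePercolation t).real (domArmEvent ![true, false] (d₂ + d') (D - d') upperHalfPlane) := by
  classical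
  obtain ⟨j, -, tt, htt, hdom⟩ := exists_rot_halfPlane_superset (N := N) hk hkN
  set G : Set (Site 2) := (triRotIsoPow j) '' upperHalfPlane with hG
  set Hd : Set (Site 2) := {w | triNorm (w + v) ≤ N} with hHd
  set A : Set (SiteConfig (Site 2)) := armEvent ![true, false, true, false] r₀ m₀ with hA
  set C : Set (SiteConfig (Site 2)) :=
    SiteConfig.relabel (triShiftIso (-(v + tt))).toEquiv ⁻¹'
      domArmEvent ![true, false] (d₂ + d') (D - d') G with hC
  have hvD : (r₀ : ℤ) + 2 * D ≤ triNorm v := by rw [hk]; exact_mod_cast h2D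
  have hvN : triNorm v ≤ N := by rw [hk]; exact_mod_cast (show k ≤ N by omega)
  have hincl : {ω : SiteConfig (Site 2) | IsPivotal (armEvent ![true, false, true, false] r₀ N) v ω} ⊆
      A ∩ C := by
    intro ω hω
    have hω' : IsPivotal (armEvent ![true, false, true, false] r₀ N) v ω := hω
    refine ⟨isPivotal_armEvent_subset_inner hr₀m (by omega)
      (by rw [hk]; exact_mod_cast (show m₀ < k by omega)) hω', ?_⟩
    have h2 := shift_mem_domArmEvent_mixed_of_isPivotal hD hvD hvN hω' hd₂ (by omega)
    have h3 := shift_mem_domArmEvent_recenter (κ := ![true, false]) (G := G) htt hrec hdom h2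
    rw [relabel_shift_shift] at h3
    exact h3
  set F : Finset (Site 2) := triAnnulus r₀ m₀ with hF
  set G₂ : Finset (Site 2) := (triAnnulus (d₂ + d') (D - d')).image fun u => u + (v + tt) with hG₂
  have hAF : DeterminedBy A ↑F := determinedBy_armEvent _ hr₀m
  have hCG : DeterminedBy C ↑G₂ :=
    determinedBy_preimage_shift (determinedBy_domArmEvent _ (by omega) G) (v + tt)
  have hG₂mem : ∀ z ∈ G₂, (k : ℤ) - D ≤ triNorm z := by
    intro z hz
    rw [hG₂, Finset.mem_image] at hz
    obtain ⟨u, hu, rfl⟩ := hz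
    rw [mem_triAnnulus] at hu
    push_cast [Nat.cast_sub (show d' ≤ D by omega)] at hu
    have h1 := triNorm_add_le (u + (v + tt)) (-(u + tt))
    rw [show u + (v + tt) + -(u + tt) = v by abel, triNorm_neg] at h1
    have h2 := triNorm_add_le u tt
    rw [htt] at h2
    rw [← hk]; omega
  have hFG₂ : Disjoint F G₂ := by
    rw [Finset.disjoint_left]
    intro z hzF hz
    rw [hF, mem_triAnnulus] at hzF
    have := hG₂mem z hz; omega
  have h1 : (triSitePercolation t).real (A ∩ C) =
      (triSitePercolation t).real A * (triSitePercolation t).real C :=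
    sitePercolation_real_inter_of_disjoint t hAF hCG hFG₂
  have h4 : (triSitePercolation t).real C =
      (triSitePercolation t).real (domArmEvent ![true, false] (d₂ + d') (D - d') upperHalfPlane) := by
    rw [hC, triSitePercolation, sitePercolation_real_preimage_relabel, hG]
    exact real_domArmEvent_rotPow t _ _ _ j
  calc (triSitePercolation t).real {ω | IsPivotal (armEvent ![true, false, true, false] r₀ N) v ω}
      ≤ (triSitePercolation t).real (A ∩ C) := measureReal_mono hincl (measure_ne_top _ _)
    _ = fourArmProbAt t r₀ m₀ *
        (triSitePercolation t).real (domArmEvent ![true, false] (d₂ + d') (D - d') upperHalfPlane) := by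
        rw [h1, h4]; rfl

end Boundary

end Literature.Probability.Percolation
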